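import Summits.NavierStokesRegularity.NavierStokesRegularity.Theses.BernoulliDeceleration
import Literature.Analysis.FluidPDE.SereginSverakPressureLocalTypeI
import HarnessLib

/-!
# Birth skeleton of the child `DeceleratingTypeIHeadRegularity` (split of `DeceleratingSetHeadBound`)

Child C2 of the prepared split of stmt-NavierStokesRegularity-3032 (route `BernoulliDeceleration`):
"a Type-I-rate bound `(T - t) Π̃ ≤ C` for the Bernoulli head on the decelerating set `D` rules out
singular points on the final slice" (Seregin–Šverák 2002 at the CRITICAL majorant). Line:

* `stub_headPeaksDecelerate` — the route's support item `HeadPeaksDecelerate` (stmt-3037, by NAME):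
  positive head values are dominated by the head at a point of `D`; it upgrades the Type-I bound
  from `D` to all of `ℝ³` (done inside `DeceleratingTypeIHeadRegularity_of`, constant `max C 0`);
* `stub_zoomLocallyTypeI` — HARDEST: under a Type-I-rate one-sided head bound on `[0,T) × ℝ³`,
  the viscosity-normalising parabolic zoom about every final-time point `(T, x₀)` is a suitable
  weak solution in `Q(0,1)` (Albritton–Barker Def. 2.1) with weak gradient and FINITE Type-I
  quantity `𝐈(Q(0,1/2)) < ∞` — the tree proves exactly this for a CONSTANT majorant
  (`SereginSverak2002.exists_zoom_typeIBound_lt_top`, via the slice estimate `ae_energy_ball_le`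
  + `albrittonBarker2019_lemma_2_6_holds`); for the critical majorant the slice estimate only gives
  `A(r,t) ≲ (T-t)^(-1/3)` and a new input (time-integrated use of the local energy inequality on
  the decelerating set, or a different test-function family) is needed;
* `stub_noLocalTypeISingularity` — `¬ LocalTypeISingularityExists` (registered OPEN statement of
  `LocalTypeI.lean`, Albritton–Barker 2019 Thm 1.1 first bullet; false under the KNSS Liouville
  conjecture (L)): the conditional input of the line, exactly as in the tree's
  `seregin_sverak_2002_of_not_localTypeISingularityExists`.

`DeceleratingTypeIHeadRegularity_of` is a REAL proof (the Albritton–Barker endgame transplanted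
from `SereginSverakPressureLocalTypeI.lean`): if `u` were not backward bounded at `(T, x₀)`, the
origin would be a backward singular point of the zoom (`isBackwardBoundedAt_of_zoom`), hence a
local Type I singular point — contradiction.
-/

set_option linter.dupNamespace false

namespace Summit.NavierStokesRegularity.NavierStokesRegularity.Cruxes.DeceleratingSetHeadBound.BirthDeceleratingTypeIHeadRegularity

open Set Metric Function MeasureTheory
open scoped ENNReal
open Literature.Analysis.FluidPDE
open Summit.NavierStokesRegularity.NavierStokesRegularity.Theses.BernoulliDeceleration

/-- Local copy of the child (VERBATIM the `statement` of `DeceleratingTypeIHeadRegularity` in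
children.json; after the split, the route decl of the same name). -/
def DeceleratingTypeIHeadRegularity : Prop :=
  ∀ (ν T : ℝ), 0 < ν → 0 < T → ∀ (u : ℝ → EuclideanSpace ℝ (Fin 3) → EuclideanSpace ℝ (Fin 3)) (p : ℝ → EuclideanSpace ℝ (Fin 3) → ℝ), Literature.Analysis.FluidPDE.IsClassicalNSSolutionOn (Set.Ico 0 T) ν 0 u p → Literature.Analysis.FluidPDE.IsLerayHopfOn T ν 0 (u 0) u → Literature.Analysis.FluidPDE.HasRapidSpatialDecay (u 0) → (∃ C : ℝ, ∀ t ∈ Set.Ico 0 T, ∀ x, Literature.Analysis.FluidPDE.timeDerivWithin (Set.Ico 0 T) (fun s z => ‖u s z‖ ^ 2) t x ≤ -(2 * ν * ‖Literature.Analysis.FluidPDE.curl (u t) x‖ ^ 2) → (T - t) * (‖u t x‖ ^ 2 / 2 + Literature.Analysis.FluidPDE.normalisedPressure (u t) x) ≤ C) → ∀ x₀ : EuclideanSpace ℝ (Fin 3), ∃ r > 0, ∃ M : ℝ, ∀ t ∈ Set.Ioo (T - r ^ 2) T, ∀ x ∈ Metric.ball x₀ r, ‖u t x‖ ≤ M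

/-- The zoom statement of the line (hypothesis: Type-I-rate head bound EVERYWHERE). -/
def ZoomLocallyTypeI : Prop :=
  ∀ (ν T : ℝ), 0 < ν → 0 < T → ∀ (u : ℝ → EuclideanSpace ℝ (Fin 3) → EuclideanSpace ℝ (Fin 3)) (p : ℝ → EuclideanSpace ℝ (Fin 3) → ℝ), Literature.Analysis.FluidPDE.IsClassicalNSSolutionOn (Set.Ico 0 T) ν 0 u p → Literature.Analysis.FluidPDE.IsLerayHopfOn T ν 0 (u 0) u → Literature.Analysis.FluidPDE.HasRapidSpatialDecay (u 0) → (∃ C : ℝ, ∀ t ∈ Set.Ico 0 T, ∀ x, (T - t) * (‖u t x‖ ^ 2 / 2 + Literature.Analysis.FluidPDE.normalisedPressure (u t) x) ≤ C) → ∀ x₀ : EuclideanSpace ℝ (Fin 3), ∃ R α β : ℝ, 0 < R ∧ 0 < α ∧ 0 < β ∧ β ≤ T ∧ Literature.Analysis.FluidPDE.IsSuitableWeakSolutionInBall 1 0 (α • Literature.Analysis.FluidPDE.stPull β R T x₀ u) (α ^ 2 • Literature.Analysis.FluidPDE.stPull β R T x₀ fun t x => p t x - (p t 0 - Literature.Analysis.FluidPDE.normalisedPressure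 (u t) 0)) ∧ Literature.Analysis.FluidPDE.HasWeakSpatialGradientOn (Literature.Analysis.FluidPDE.parabolicCylinderOpens 1 (0 : ℝ × EuclideanSpace ℝ (Fin 3))) (α • Literature.Analysis.FluidPDE.stPull β R T x₀ u) ((α * R) • Literature.Analysis.FluidPDE.stPull β R T x₀ fun t x => fderiv ℝ (u t) x) ∧ Literature.Analysis.FluidPDE.typeIBound (Literature.Analysis.FluidPDE.parabolicCylinder (1 / 2) (0 : ℝ × EuclideanSpace ℝ (Fin 3))) (α • Literature.Analysis.FluidPDE.stPull β R T x₀ u) (α ^ 2 • Literature.Analysis.FluidPDE.stPull β R T x₀ fun t x => p t x - (p t 0 - Literature.Analysis.FluidPDE.normalisedPressure (u t) 0)) ((α * R) • Literature.Analysis.FluidPDE.stPull β R T x₀ fun t x => fderiv ℝ (u t) x) < ⊤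

/-- STUB 1 (= route support item `HeadPeaksDecelerate`, stmt-NavierStokesRegularity-3037):
positive head values are dominated by the head at a strongly decelerating point. [M; folklore:
decay of `u(t)`, `p̃[u(t)]` at infinity + every-time pressure gauge + `HeadMaxPointLemma`] -/
theorem stub_headPeaksDecelerate : HeadPeaksDecelerate := by
  sorry

/-- STUB 2 (HARDEST): a Type-I-rate one-sided head bound on `[0, T) × ℝ³` makes the
viscosity-normalising zoom about every final-time point locally Type I in the sense of
Albritton–Barker (suitable in `Q(0,1)`, weak gradient, `𝐈(Q(0,1/2)) < ∞`). [L/XL; the constant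
majorant case is the tree's `SereginSverak2002.exists_zoom_typeIBound_lt_top`] -/
theorem stub_zoomLocallyTypeI : ZoomLocallyTypeI := by
  sorry

/-- STUB 3 (conditional input): no suitable weak solution has a local Type I singular point
(Albritton–Barker 2019 Thm 1.1, first bullet, registered OPEN; refuted by the KNSS Liouville
conjecture (L)). [conjecture-level; shared with every Type-I line of the summit] -/
theorem stub_noLocalTypeISingularity : ¬ LocalTypeISingularityExists := by
  sorry

/-- **The child from the stubs** (real proof: HeadPeaks upgrade `D → ℝ³`, then the
Albritton–Barker endgame at a final-time point). -/
theorem DeceleratingTypeIHeadRegularity_of :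
    HeadPeaksDecelerate → ZoomLocallyTypeI → ¬ LocalTypeISingularityExists →
      DeceleratingTypeIHeadRegularity := by
  intro hPeak hZoom hno ν T hν hT u p hsol hLH hdec hTypeI x₀
  obtain ⟨C, hC⟩ := hTypeI
  -- Step 1 (`HeadPeaksDecelerate`): the Type-I bound holds on all of `[0, T) × ℝ³`
  have hall : ∀ t ∈ Set.Ico 0 T, ∀ x,
      (T - t) * (‖u t x‖ ^ 2 / 2 + normalisedPressure (u t) x) ≤ max C 0 := by
    intro t ht x
    have hTt : 0 ≤ T - t := by linarith [ht.2]
    by_cases hpos : 0 < ‖u t x‖ ^ 2 / 2 + normalisedPressure (u t) x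
    · obtain ⟨y, hyD, hxy⟩ := hPeak ν T hν hT u p hsol hLH hdec t ht x hpos
      calc (T - t) * (‖u t x‖ ^ 2 / 2 + normalisedPressure (u t) x)
          ≤ (T - t) * (‖u t y‖ ^ 2 / 2 + normalisedPressure (u t) y) :=
            mul_le_mul_of_nonneg_left hxy hTt
        _ ≤ C := hC t ht y hyD
        _ ≤ max C 0 := le_max_left _ _
    · exact (mul_nonpos_of_nonneg_of_nonpos hTt (not_lt.mp hpos)).trans (le_max_right _ _)
  -- Step 2: the zoom about `(T, x₀)` is locally Type I
  obtain ⟨R, α, β, hR, hα, hβ, hβT, hball, hGv, htypeI⟩ :=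
    hZoom ν T hν hT u p hsol hLH hdec ⟨max C 0, hall⟩ x₀
  -- Step 3: were `u` not backward bounded at `(T, x₀)`, the origin would be a Type I singular
  -- point of the zoom
  by_contra hnot
  apply hno
  have hsing : IsBackwardSingularPoint (α • stPull β R T x₀ u) (0 : ℝ × EuclideanSpace ℝ (Fin 3)) := by
    intro r hr
    by_contra hfin
    have hfin' : eLpNorm (uncurry (α • stPull β R T x₀ u)) ⊤
        (volume.restrict (parabolicCylinder (min r 1) (0 : ℝ × EuclideanSpace ℝ (Fin 3)))) < ⊤ := by
      refine lt_of_le_of_lt (eLpNorm_mono_measure _ (Measure.restrict_mono ?_ le_rfl))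
        (lt_top_iff_ne_top.2 hfin)
      exact SuitableCompactness.parabolicCylinder_zero_mono (le_min hr.le zero_le_one)
        (min_le_left _ _)
    exact hnot (SereginSverak2002.isBackwardBoundedAt_of_zoom hsol x₀ hR hα hβ hβT
      (lt_min hr one_pos) (min_le_right _ _) hfin')
  refine ⟨1 / 2, 0, α • stPull β R T x₀ u,
    α ^ 2 • stPull β R T x₀ (fun t x => p t x - (p t 0 - normalisedPressure (u t) 0)),
    by norm_num, ?_, hsing, _,
    hGv.mono (SuitableCompactness.parabolicCylinderOpens_zero_mono (by norm_num) (by norm_num)),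
    htypeI⟩
  exact SuitableCompactness.isSuitableWeakSolutionInBall_of_le_radius hball (by norm_num)
    (by norm_num)

end Summit.NavierStokesRegularity.NavierStokesRegularity.Cruxes.DeceleratingSetHeadBound.BirthDeceleratingTypeIHeadRegularity
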